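import Summits.ResolutionOfSingularities.ResolutionOfSingularities.Theorems.FrobeniusLadderFInjectiveMacaulayficationP2d4F5Specimen
import Literature.AlgebraicGeometry.Resolution.AffineBlowupAlgebra
import Mathlib.RingTheory.Localization.Away.Basic
import HarnessLib

/-!
# (N1-Z) The Rees chart `D(z̄)` of `Bl_τ(P2d4F5)` carries NO point over the vertex: `𝔪_v · A₀[τ/z̄] = (1)`
# (crux `FInjectiveMacaulayfication` stmt-ResolutionOfSingularities-15315, chain w45a; res-L1-w45a-plan-1 R18.32 «(N1) ROW #2 TWO-SIDED → stub-3»;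
# seat res-L1-w45a-stub-3 g10; res-L1-w45a-stub-1's observation l.80439 «D(z) carries NO point over v: 1 = x·(x/z) + Σ y·(y²/z)² ∈ 𝔪_v·B_z from f/z²»)

[OURS · L1 W4.5a] Support file (`--supports stmt-ResolutionOfSingularities-15315 --as helper`); replaces the role of NO printed item; NOT a statement of
any manuscript; def-free; UNCONDITIONalgebraMap (MvPolynomial (Fin 5) k ⧸ Ideal.span {f}) (Localization.Away (Ideal.Quotient.mk (Ideal.span {f}) (X 4) : MvPolynomial (Fin 5) k ⧸ Ideal.span {f})); characteristic-free. AI-written (AI review is weaker than expert review).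

`A₀ = k[X0..X4]/(f)`, `f = X4² + X0²X4 + X1⁵ + X2⁵ + X3⁵`, `τ = Ideal.span {x̄0, x̄1², x̄2², x̄3², x̄4}`, `v` the vertex. In `A₀[τ/z̄] ⊆ A₀[1/z̄]` the elements
`x̄/z̄, ȳ²/z̄, ū²/z̄, t̄²/z̄` lie in the blow-up algebra, and dividing `f = 0` by `z̄²` gives `1 = −(x̄·(x̄/z̄) + ȳ·(ȳ²/z̄)² + ū·(ū²/z̄)² + t̄·(t̄²/z̄)²) ∈ 𝔪_v·A₀[τ/z̄]`.
* `ident_z` — the ring identity; ★ `map_vertex_eq_top` — `𝔪_v.map (A₀ → A₀[τ/z̄]) = ⊤`, the input of res-L1-w45a-stub-1's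
  `LocalBlowupInputFromCharts.not_comap_eq_of_map_eq_top` (p627935): the chart `D(z̄t)` contributes no stalk over `v` to the CM assembly of row #2.
[cite: GortzWedhorn2020, (13.19) p. 415]
-/

-- single-problem summit: the doubled namespace component is forced
set_option linter.dupNamespace false

noncomputable section

namespace Summit.ResolutionOfSingularities.ResolutionOfSingularities.Theorems.FInjectiveMacaulayfication.TauFloorF5ZChart

open MvPolynomial IsLocalization Literature.AlgebraicGeometry.Resolution
open Summit.ResolutionOfSingularities.ResolutionOfSingularities.Theorems.FInjectiveMacaulayfication

variable (k : Type) [Field k]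

/-- `1 + (x·(x·i) + y·(y²·i)² + u·(u²·i)² + t·(t²·i)²) = 0` when `f(x,y,u,t,z) = 0` and `z·i = 1`. [ring identity] -/
theorem ident_z {L : Type} [CommRing L] (x y z u t i : L) (hF : z ^ 2 + x ^ 2 * z + y ^ 5 + u ^ 5 + t ^ 5 = 0) (hzi : z * i = 1) :
    1 + (x * (x * i) + y * (y ^ 2 * i) ^ 2 + u * (u ^ 2 * i) ^ 2 + t * (t ^ 2 * i) ^ 2) = 0 := by
  linear_combination i ^ 2 * hF + (-(1 + z * i + x ^ 2 * i)) * hzi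

set_option synthInstance.maxHeartbeats 200000 in
set_option maxHeartbeats 1600000 in
-- instance search on `Localization.Away` over the quotient ring is slow (as in `TauFloorOneCIChartDomain`)
/-- ★ **`𝔪_v · A₀[τ/z̄] = (1)`**: the Rees chart `D(z̄)` of `Bl_τ(P2d4F5)` has no prime over the vertex. [cite: GortzWedhorn2020, (13.19) p. 415] -/
theorem map_vertex_eq_top (f : MvPolynomial (Fin 5) k) (hf : f = X 4 ^ 2 + X 0 ^ 2 * X 4 + X 1 ^ 5 + X 2 ^ 5 + X 3 ^ 5)
    (v : AlgebraicGeometry.Spec (.of (MvPolynomial (Fin 5) k ⧸ Ideal.span {f})))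
    (hv : v.asIdeal = Ideal.span (Set.range fun j : Fin 5 => Ideal.Quotient.mk (Ideal.span {f}) (X j))) :
    v.asIdeal.map (algebraMap (MvPolynomial (Fin 5) k ⧸ Ideal.span {f}) (blowupAlgebra (Ideal.span {Ideal.Quotient.mk (Ideal.span {f}) (X 0), Ideal.Quotient.mk (Ideal.span {f}) (X 1) ^ 2,
          Ideal.Quotient.mk (Ideal.span {f}) (X 2) ^ 2, Ideal.Quotient.mk (Ideal.span {f}) (X 3) ^ 2, Ideal.Quotient.mk (Ideal.span {f}) (X 4)} :
            Ideal (MvPolynomial (Fin 5) k ⧸ Ideal.span {f})) (Ideal.Quotient.mk (Ideal.span {f}) (X 4)))) = ⊤ := by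
  classical
  let mkA : MvPolynomial (Fin 5) k →+* MvPolynomial (Fin 5) k ⧸ Ideal.span {f} := Ideal.Quotient.mk (Ideal.span {f})
  let τ : Ideal (MvPolynomial (Fin 5) k ⧸ Ideal.span {f}) := Ideal.span {mkA (X 0), mkA (X 1) ^ 2, mkA (X 2) ^ 2, mkA (X 3) ^ 2, mkA (X 4)}
  let L := Localization.Away (mkA (X 4))
  let B : Subalgebra (MvPolynomial (Fin 5) k ⧸ Ideal.span {f}) L := blowupAlgebra τ (mkA (X 4))
  let ι : (MvPolynomial (Fin 5) k ⧸ Ideal.span {f}) →+* L := algebraMap _ _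
  let inv : L := Away.invSelf (mkA (X 4))
  have hzi : ι (mkA (X 4)) * inv = 1 := Away.mul_invSelf (S := L) (mkA (X 4))
  have hF : ι (mkA (X 4)) ^ 2 + ι (mkA (X 0)) ^ 2 * ι (mkA (X 4)) + ι (mkA (X 1)) ^ 5 + ι (mkA (X 2)) ^ 5 + ι (mkA (X 3)) ^ 5 = 0 := by
    have h0 : mkA (X 4 ^ 2 + X 0 ^ 2 * X 4 + X 1 ^ 5 + X 2 ^ 5 + X 3 ^ 5) = 0 := by
      rw [← hf]; exact Ideal.Quotient.eq_zero_iff_mem.mpr (Ideal.mem_span_singleton_self f)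
    have h1 := congrArg ι h0
    rw [map_zero] at h1
    simpa only [map_add, map_mul, map_pow] using h1
  -- the four elements of `B`
  have m0 : ι (mkA (X 0)) * inv ∈ B := div_mem_blowupAlgebra τ (mkA (X 4)) (Ideal.subset_span (by simp))
  have m1 : ι (mkA (X 1)) ^ 2 * inv ∈ B := by rw [← map_pow ι]; exact div_mem_blowupAlgebra τ (mkA (X 4)) (Ideal.subset_span (by simp))
  have m2 : ι (mkA (X 2)) ^ 2 * inv ∈ B := by rw [← map_pow ι]; exact div_mem_blowupAlgebra τ (mkA (X 4)) (Ideal.subset_span (by simp))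
  have m3 : ι (mkA (X 3)) ^ 2 * inv ∈ B := by rw [← map_pow ι]; exact div_mem_blowupAlgebra τ (mkA (X 4)) (Ideal.subset_span (by simp))
  -- the identity in `B`
  have key : (1 : B) = -(algebraMap _ B (mkA (X 0)) * ⟨_, m0⟩ + algebraMap _ B (mkA (X 1)) * ⟨_, m1⟩ ^ 2 + algebraMap _ B (mkA (X 2)) * ⟨_, m2⟩ ^ 2 +
      algebraMap _ B (mkA (X 3)) * ⟨_, m3⟩ ^ 2) := by
    rw [eq_neg_iff_add_eq_zero]
    apply Subtype.ext
    simp only [Subalgebra.coe_add, Subalgebra.coe_mul, Subalgebra.coe_pow, Subalgebra.coe_one, Subalgebra.coe_zero, Subalgebra.coe_algebraMap]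
    exact ident_z _ _ _ _ _ inv hF hzi
  -- every `x̄ⱼ` lies in `𝔪_v`
  have hmem : ∀ j : Fin 5, mkA (X j) ∈ v.asIdeal := fun j => by rw [hv]; exact Ideal.subset_span ⟨j, rfl⟩
  rw [Ideal.eq_top_iff_one, key]
  refine neg_mem (Ideal.add_mem _ (Ideal.add_mem _ (Ideal.add_mem _ ?_ ?_) ?_) ?_)
  · exact Ideal.mul_mem_right _ _ (Ideal.mem_map_of_mem _ (hmem 0))
  · exact Ideal.mul_mem_right _ _ (Ideal.mem_map_of_mem _ (hmem 1))
  · exact Ideal.mul_mem_right _ _ (Ideal.mem_map_of_mem _ (hmem 2))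
  · exact Ideal.mul_mem_right _ _ (Ideal.mem_map_of_mem _ (hmem 3))

end Summit.ResolutionOfSingularities.ResolutionOfSingularities.Theorems.FInjectiveMacaulayfication.TauFloorF5ZChart

end
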